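import Summits.KontsevichZagierPeriods.Zeta5Search.LaiSweepShard

/-!
# `κ₃` sweep certificate — shard file 057 of 127 (shards 399–405 of 889)

HONEST FRAMING. Systematic search; no irrationality claim unless certified. This file only checks,
by `decide +kernel`, shards 399–405 of the order-cell sweep of the `κ₃` point `(74, 2180, 444; δ74)`
(engine `LaiSweepEngine`, soundness `LaiSweepJump/Free/Eval/Shard/Kappa3`; a shard is `⟨regime, n,
p, q, p', q', Lo, Up⟩`: `n` cells from `p/q` to `p'/q'` with integer rate sums in `[Lo, Up]`, `K =
128`, `D = 2^40`). It draws NO conclusion: only the capstone `LaiKappa3SweepCert`, which needs all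
127 shard files, does. Kernel cost of this file ≈ 560 cells × 0.3 s.
-/

namespace Summit.KontsevichZagierPeriods.Zeta5Search.Sweep

set_option maxHeartbeats 100000000 in
/-- Shard 399: 80 cells of regime B from `81/211` to `52/135`.
[cite: Lai2024BallRivoal, §4 Lemma 4.3] -/
theorem shard399 :
    Shard.check 128 (2^40)
      ⟨true, 80, 81, 211, 52, 135, 19003327735181, 21362125191718⟩ = true := by
  decide +kernel

set_option maxHeartbeats 100000000 in
/-- Shard 400: 80 cells of regime B from `52/135` to `114/295`.
[cite: Lai2024BallRivoal, §4 Lemma 4.3] -/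
theorem shard400 :
    Shard.check 128 (2^40)
      ⟨true, 80, 52, 135, 114, 295, 18315902442072, 20605119112217⟩ = true := by
  decide +kernel

set_option maxHeartbeats 100000000 in
/-- Shard 401: 80 cells of regime B from `114/295` to `107/276`.
[cite: Lai2024BallRivoal, §4 Lemma 4.3] -/
theorem shard401 :
    Shard.check 128 (2^40)
      ⟨true, 80, 114, 295, 107, 276, 18054400393042, 20327082606790⟩ = true := by
  decide +kernel

set_option maxHeartbeats 100000000 in
/-- Shard 402: 80 cells of regime B from `107/276` to `149/383`.
[cite: Lai2024BallRivoal, §4 Lemma 4.3] -/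
theorem shard402 :
    Shard.check 128 (2^40)
      ⟨true, 80, 107, 276, 149, 383, 19629660234988, 22119180347861⟩ = true := by
  decide +kernel

set_option maxHeartbeats 100000000 in
/-- Shard 403: 80 cells of regime B from `149/383` to `135/346`.
[cite: Lai2024BallRivoal, §4 Lemma 4.3] -/
theorem shard403 :
    Shard.check 128 (2^40)
      ⟨true, 80, 149, 383, 135, 346, 16496620304493, 18602899212562⟩ = true := by
  decide +kernel

set_option maxHeartbeats 100000000 in
/-- Shard 404: 80 cells of regime B from `135/346` to `101/258`.
[cite: Lai2024BallRivoal, §4 Lemma 4.3] -/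
theorem shard404 :
    Shard.check 128 (2^40)
      ⟨true, 80, 135, 346, 101, 258, 18756047464544, 21167687468475⟩ = true := by
  decide +kernel

set_option maxHeartbeats 100000000 in
/-- Shard 405: 80 cells of regime B from `101/258` to `86/219`.
[cite: Lai2024BallRivoal, §4 Lemma 4.3] -/
theorem shard405 :
    Shard.check 128 (2^40)
      ⟨true, 80, 101, 258, 86, 219, 17589097981074, 19866217840859⟩ = true := by
  decide +kernel

/-- The checked shards of this file, in order. [folklore] -/
def shards057 : List (CheckedShard 128 (2^40)) :=
  [⟨_, shard399⟩, ⟨_, shard400⟩, ⟨_, shard401⟩, ⟨_, shard402⟩, ⟨_, shard403⟩,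
    ⟨_, shard404⟩, ⟨_, shard405⟩]

end Summit.KontsevichZagierPeriods.Zeta5Search.Sweep
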